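import Literature.MathematicalPhysics.QuantumFieldTheory.Balaban1983to89.B9Eq3132QGtildeQInvLetterClosed

/-!
# `Balaban1983to89.B9Eq3126H1kPiSupRowClosed` — T. Bałaban, *Propagators for lattice gauge theories in a background field*, Commun. Math. Phys. **99** (1985) 389–434
# [Balaban1985BackgroundPropagators] (3.126) p. 420, (3.133) p. 422, (3.147) p. 425, Thm 3.11 p. 416; [Balaban1985Variational] (45) p. 285, (103) p. 293, (110)–(111)
# p. 294: **THE LOCAL SUP LETTER OF `H̃_k = G̃_kQ_k†(Q_kG̃_kQ_k†)⁻¹` ON THE CELL's MODEL, ∃-FIRST, HEIGHT-FREE** — (K65) `B9Eq3126H1kSupRowClosed` RE-RUN AT PRINT's `G̃_k`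
# (the NE9 owner's RULING R-ne9p1-g97-4 (2)(b), journal `HOME/CLAIMS.log` l.66556): `H̃_k = B11Eq103H1Complex.H1LatticeK hposπ hQ` (= `G̃_k ∘ Q_k† ∘ K̃` by
# `H1LatticeK_eq`), the three letters (L)(G̃_k) = (K77), (L)(Q_k†) = (K65)'s station, (L)(K̃) = (K80), composed by (K65)'s `local_letter_H1_of_letters`

statement-level skeleton of published theorems with citation tags; proofs where landed; nothing here is a claim about the Yang–Mills mass gap

CITATION HEADER (lean-in-tree rule).  Audit cell `pub-balaban`, sub-cell `t4`, BINDER row NE9; NE9 crux-team LEAF PROVER 05 (`b2b-balaban-t4-ne9-formalise-leaf-05`, gen 88;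
(K81)).  Composed BY NAME: (K77) `exists_local_letters_G1LatticeKPi`, (K80) `exists_local_letter_KinvLatticeKPi`, `B9Eq315QkSingleBondLetter.norm_adjoint_QkW_apply_le_local_sharp`,
(K63) `letter_of_range`, (K65) `B9Eq3126H1SupRowOfLetters.local_letter_H1_of_letters`, `B11Eq103H1Complex.H1LatticeK_eq`.  Source READ first-hand
(`paper:balaban1985-cmp99-background-propagators`, PDF + 388): pp. 416, 420–422, 425.  [folklore] letter algebra; NOTHING of print's (3.126) ∕ (3.133) ∕ Thm 3.11 ∕ 3.13
is asserted, valued or discharged.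
WHAT IS PROVED (sorry-free; no `def`).  **`exists_local_letter_H1LatticeKPi`**: `∃ (α₁, j₁, B, δ)` BEFORE (K80)'s binder block such that for every coarse-bond field `z`
supported over the bonds based at `v` with `‖z‖_∞ ≤ F` and every fine bond `b`: `‖(H̃_kz)(b)‖ ≤ B·e^{−δ·d_m(Π(b₋), v)}·F` — `B = B_K·(M_Q†e^κ)·K·B_T·K`, `δ = κ∕2`,
`κ = min(δ_K77, δ_K80)`, `j₁ = min(j₁(K77), j₁(K80))`, `α₁ = min` of the two radii.
HONEST SCOPE.  `hpos′`, `hpos`, `hposπ`, `hQ`, the windows, E162's data, `c₀ = η^d`, `‖J‖ ≤ j₀` stay HYPOTHESES; constants crude; «NE9 ⇐ the named binders»; NE9 NOT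
PRINTED ∕ NOT PROVED; row WALLED ON A MODEL (O-NE9-1; #5 UNRULED); spine PROVED 0∕9; rung (B)+1 on a finite T⁴ — NOT infinite volume, NOT mass gap, NOT BetaPertH, NOT
Clay.  HONEST DEPENDENCY: continuum YM on T⁴ ⇐ BetaPertH ∧ nine spine estimates (0/9 proved); BetaPertH ⇐ (D1) ∧ (D4) ∧ CAP+tail; G-an2-4 gates asym, D1 and NE2/3/4.
NEW file importing (K80) only; nothing modified.  Net new unproved facts: 0.
-/

noncomputable section

set_option autoImplicit false

open scoped InnerProductSpace ComplexConjugate BigOperators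

namespace Literature.MathematicalPhysics.QuantumFieldTheory.Balaban1983to89.B9Eq3126H1kPiSupRowClosed



open B4Sect5Torus (TSite tdist tdist_nonneg tdist_symm tdist_self tdist_triangle torusSum_le)
open B4Sect5Proof (latticeConst latticeConst_nonneg)
open B9SectCLatticeCarrier (Bond DirPair bpos btgt shift unshift)
open B9Eq311L2Pairing (WL2)
open B9Eq319QprimeTorus (fineP blockCoord)
open B7Prop1Explicit (U1 Wcx boxVec)
open B11Eq103H1Complex (SiteL2K BondL2K greenK covDerivL2K covDivL2K G1LatticeK KinvLatticeK H1LatticeK H1LatticeK_eq)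
open B9Eq310DeltaPrime (plaqHolU)
open B9Eq310HessianOperator (adTransportW hessOp)
open B9Eq310HessianHermitian (adTransportW_adjoint)
open B9Eq315QTorus (perCfg cornerSite)
open B9Eq315QTower (towerP UlevOf)
open B9Eq316TowerFlatIsOneStep (towerP_eq_fineP_pow siteCast)
open B9Eq326OperatorTower (QprimeTowerW QkW RofUk laplaceAk G1k)
open B9Eq324DeltaPrimeATower (laplacePrimeAk GpOfUk)
open B9Eq33CovDerivLocalLetterTower (tdist_bigBlock_bpos_btgt_le_one)
open B9Eq3117GaugeModeStencilLettersTower (local_hessOp_covDerivL2K_tower local_covDivL2K_hessOp_tower)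
open B9Eq3130GtildePairRowsClosedTower (exists_local_letters_G1LatticeKPi)
open B9Eq3132QGtildeQInvLetterClosed (exists_local_letter_KinvLatticeKPi)
open B9Eq3119DeltaPiTower (piOfUk laplaceAkPi)

variable {d : ℕ} (hd : 1 ≤ d) (L : ℕ) [NeZero L] (hL : 1 ≤ L) (hL3 : 3 ≤ L)
  {𝔸 : Type*} [NormedRing 𝔸] [NormedAlgebra ℂ 𝔸] [CompleteSpace 𝔸] [NormOneClass 𝔸] [StarRing 𝔸] [NormedStarGroup 𝔸] [StarModule ℂ 𝔸]
  {W : Type*} [NormedAddCommGroup W] [InnerProductSpace ℂ W] [FiniteDimensional ℂ W] (φ : W ≃ₗ[ℂ] 𝔸)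
  {Mφ Mφ' : ℝ} (hMφ : 0 ≤ Mφ) (hMφ' : 0 ≤ Mφ') (hφ : ∀ w, ‖φ w‖ ≤ Mφ * ‖w‖) (hφ' : ∀ X, ‖φ.symm X‖ ≤ Mφ' * ‖X‖) (hstar : ∀ X : 𝔸, ‖star X‖ ≤ ‖X‖)
  {a : ℝ} (ha : 0 < a) {a' : ℝ} (ha' : 0 < a') {ϱ : ℝ} (hϱ0 : 0 ≤ ϱ) (hϱ1 : ϱ < 1)
  (τ : 𝔸 →ₗ[ℂ] ℂ) {Cτ : ℝ} (hτ : ∀ X, ‖τ X‖ ≤ Cτ * ‖X‖) (hCτ : 0 ≤ Cτ) {Mτ : ℝ} (hτm : ∀ X Y : 𝔸, ‖τ (X * Y)‖ ≤ Mτ * ‖X‖ * ‖Y‖) (hMτ : 0 ≤ Mτ)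
  {ρw : ℝ} (hρw : 0 ≤ ρw)
  (hτ₁ : ∀ X : 𝔸, τ (star X) = conj (τ X)) (hτ₂ : ∀ X Y : 𝔸, τ (X * Y) = τ (Y * X)) (hφτ : ∀ X Y : 𝔸, ⟪φ.symm X, φ.symm Y⟫_ℂ = τ (star X * Y))
  (AQ : ℝ)

open B9Eq326G1SupRowOfLetters (letter_comp letter_mono)
open B9Eq3126H1SupRowOfLetters (letter_of_range local_letter_H1_of_letters)
open B9Eq349BlockDistanceWeight (tdist_shift_le_one)
open B9Eq315QkSingleBondLetter (norm_adjoint_QkW_apply_le_local_sharp)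

omit [NeZero L] in
/-- `e^{−r t} ≤ e^{−κ t}` for `κ ≤ r`, `0 ≤ t`. [folklore] -/
private theorem exp_weaken' {r κ t : ℝ} (hκ : κ ≤ r) (ht : 0 ≤ t) : Real.exp (-(r * t)) ≤ Real.exp (-(κ * t)) :=
  Real.exp_le_exp.2 (by nlinarith)

set_option maxHeartbeats 400000 in -- margin only: passes at the default 200 000 (cert), but the sibling (K76) sat on the farm's heartbeat cliff (ops-buildfix-2 g21, HOME/INBOX 19:03Z) — same binder block, same shape
include hd hL hL3 hMφ hMφ' hφ hφ' hstar ha ha' hϱ0 hϱ1 hτ hCτ hτm hMτ hρw hτ₁ hτ₂ hφτ in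
/-- **THE LOCAL SUP LETTER OF `H̃_k = G̃_kQ_k†(Q_kG̃_kQ_k†)⁻¹`** — (K65)'s `local_letter_H1_of_letters` at the three letters (L)(G̃_k; B_T, κ) ((K77) `.1`),
(L)(Q_k†; M_Q†e^κ, κ) (`norm_adjoint_QkW_apply_le_local_sharp`, range `1`, `letter_of_range`), (L)(K̃; B_K, κ) ((K80)), `κ = min` of the two rates, one rate loss.
[cite: Balaban1985BackgroundPropagators, (3.126) p.420, (3.133) p.422, Thm 3.11 p.416] [cite: Balaban1985Variational, (45) p.285, (103) p.293] -/
theorem exists_local_letter_H1LatticeKPi :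
    ∃ α₁ j₁ B δ : ℝ, 0 < α₁ ∧ 0 < j₁ ∧ 0 ≤ B ∧ 0 < δ ∧
      ∀ (n : ℕ) (η : ℝ) (_hηL : η * (L : ℝ) ^ (n + 1) = 1) (c₀ c₁ : ℝ) [Fact (0 < c₀)] [Fact (0 < c₁)]
        (_hw : c₀ * ((L : ℝ) ^ (n + 1)) ^ d = c₁) (_hρ : |η| ^ d / c₀ ≤ ρw) (m : Fin d → ℕ) [∀ i, NeZero (m i)] (_hm : ∀ i, 1 ≤ m i)
        (U : Bond d (towerP L m (n + 1)) → 𝔸ˣ) (αU : ℕ → ℝ) (_hα0 : ∀ j, 0 ≤ αU j) (hα1 : ∀ j, αU j ≤ 1 / 64)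
        (hαL : ∀ j, 50 * (d + 1) * αU j * (L : ℝ) ^ d ≤ 1 / 2)
        (hU1 : ∀ (j : ℕ) (x : B7Prop1Explicit.Site d) (k : Fin d), perCfg (towerP L m (j + 1)) (UlevOf L m (n + 1) U j) x k ∈ U1 𝔸)
        (hreg : ∀ (j : ℕ) (y : TSite d (towerP L m j)) (k : Fin d) (ρ' : Fin d → Fin L),
          ‖((Wcx L (perCfg (towerP L m (j + 1)) (UlevOf L m (n + 1) U j)) (cornerSite L y) k (boxVec L ρ') : 𝔸ˣ) : 𝔸) - 1‖ ≤ αU j)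
        (εU : ℕ → ℝ) (_hεU : ∀ j, 0 ≤ εU j) (_hUε : ∀ (j : ℕ) (b : Bond d (towerP L m (j + 1))), ‖(UlevOf L m (n + 1) U j b : 𝔸) - 1‖ ≤ εU j)
        (_hLb : ∀ (j : ℕ) (b : Bond d (towerP L m (j + 1))), UlevOf L m (n + 1) U j b ∈ U1 𝔸)
        (α : ℝ) (_hα : 0 ≤ α) (_hαle : α ≤ α₁)
        (hUst : ∀ b, star (U b : 𝔸) = (((U b)⁻¹ : 𝔸ˣ) : 𝔸)) (_hUb : ∀ b, U b ∈ U1 𝔸) (_hUη : ∀ b, ‖(U b : 𝔸) - 1‖ ≤ α * η)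
        (_hpl : ∀ p : B9SectCLatticeCarrier.Plaq d (towerP L m (n + 1)), ‖(plaqHolU U p : 𝔸) - 1‖ ≤ α * η ^ 2)
        (_hUgrad : ∀ (x : TSite d (towerP L m (n + 1))) (μ : Fin d), ‖(U (x, μ) : 𝔸) - U (unshift μ x, μ)‖ ≤ α * η ^ 2)
        (_hRlev : ∀ (j : ℕ) (b : Bond d (towerP L m (j + 1))) (w : W), ‖adTransportW φ (UlevOf L m (n + 1) U j) b w‖ ≤ ‖w‖)
        (_hεg : ∀ j < n + 1, εU j ≤ α * ϱ ^ j) (_hAQ : ∑ j ∈ Finset.range (n + 1), αU j ≤ AQ)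
        (hpos' : ∀ x : SiteL2K ℂ d (towerP L m (n + 1)) c₀ W, x ≠ 0 → 0 < RCLike.re ⟪x, laplacePrimeAk L m n φ η U a' (c₁ := c₁) x⟫_ℂ)
        (hpos : ∀ x : BondL2K ℂ d (towerP L m (n + 1)) c₀ W, x ≠ 0 →
          0 < RCLike.re ⟪x, laplaceAk L m n φ η U hL αU hα1 hU1 hreg τ (c₀ := c₀) (c₁ := c₁) a x⟫_ℂ)
        (_hc₀η : c₀ = η ^ d) (j₀ : ℝ) (_hJ : ∀ μ y, ‖B9Eq39Adjoint.J (fun μ => B9Eq33CovDerivVector.shiftEquiv μ) (fun μ y => U (y, μ)) η μ y‖ ≤ j₀) (_hj : j₀ ≤ j₁)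
        (hposπ : ∀ x : BondL2K ℂ d (towerP L m (n + 1)) c₀ W, x ≠ 0 →
          0 < RCLike.re ⟪x, laplaceAkPi L m n φ τ η U a' hpos' hL αU hα1 hU1 hreg (c₁ := c₁) a x⟫_ℂ)
        (hQ : Function.Surjective (QkW L m n φ U hL αU hα1 hU1 hreg (c₀ := c₀) (c₁ := c₁)))
        (v : TSite d m) (z : BondL2K ℂ d m c₁ W) (F : ℝ)
        (_hzv : ∀ b', bpos b' ≠ v → WL2.equiv ℂ (fun _ : Bond d m => c₁) W z b' = 0)
        (_hzF : ∀ b', ‖WL2.equiv ℂ (fun _ : Bond d m => c₁) W z b'‖ ≤ F) (b : Bond d (towerP L m (n + 1))),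
        ‖WL2.equiv ℂ (fun _ : Bond d (towerP L m (n + 1)) => c₀) W (H1LatticeK hposπ hQ z) b‖ ≤
          B * Real.exp (-(δ * tdist m (blockCoord (L ^ (n + 1)) m (siteCast (towerP_eq_fineP_pow L m (n + 1)) (bpos b))) v)) * F := by
  classical
  obtain ⟨αT, jT, BT, δT, hαT, hjT, hBT, hδT, HT⟩ :=
    exists_local_letters_G1LatticeKPi hd L hL hL3 φ hMφ hMφ' hφ hφ' hstar ha ha' hϱ0 hϱ1 τ hτ hCτ hτm hMτ hρw hτ₁ hτ₂ hφτ AQ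
  obtain ⟨αK, jK, BK, δK, hαK, hjK, hBK, hδK, HKi⟩ :=
    exists_local_letter_KinvLatticeKPi hd L hL hL3 φ hMφ hMφ' hφ hφ' hstar ha ha' hϱ0 hϱ1 τ hτ hCτ hτm hMτ hρw hτ₁ hτ₂ hφτ AQ
  obtain ⟨κ, hκdef⟩ : ∃ κ : ℝ, κ = min δT δK := ⟨_, rfl⟩
  have hκ0 : 0 < κ := by rw [hκdef]; exact lt_min hδT hδK
  have hκT : κ ≤ δT := by rw [hκdef]; exact min_le_left _ _
  have hκK : κ ≤ δK := by rw [hκdef]; exact min_le_right _ _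
  obtain ⟨K, hKdef⟩ : ∃ K : ℝ, K = latticeConst d (κ - κ / 2) := ⟨_, rfl⟩
  have hK0 : 0 ≤ K := by rw [hKdef]; exact latticeConst_nonneg d (sub_pos.2 (half_lt_self hκ0)).le
  obtain ⟨MQa, hMQa⟩ : ∃ M : ℝ, M = Mφ' * Real.exp (100 * d * (d + 1) * (L : ℝ) ^ d * AQ) * Mφ * ((2 * d : ℕ) : ℝ) := ⟨_, rfl⟩
  have hMQa0 : 0 ≤ MQa := by rw [hMQa]; positivity
  obtain ⟨Bs, hBs⟩ : ∃ B : ℝ, B = BK * (MQa * Real.exp (κ * 1)) * K * BT * K := ⟨_, rfl⟩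
  have hBs0 : 0 ≤ Bs := by rw [hBs]; positivity
  refine ⟨min αT αK, min jT jK, Bs, κ / 2, lt_min hαT hαK, lt_min hjT hjK, hBs0, half_pos hκ0, ?_⟩
  intro n η hηL c₀ c₁ _ _ hw hρ m _ hm U αU hα0 hα1 hαL hU1 hreg εU hεU hUε hLb α hα hαle hUst hUb hUη hpl hUgrad hRlev hεg hAQ hpos' hpos hc₀η j₀ hJ hj
    hposπ hQ v z F hzv hzF b
  have hc₀ : (0 : ℝ) < c₀ := Fact.out
  haveI : Nonempty (Bond d m) := ⟨(v, ⟨0, hd⟩)⟩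
  have b' : Bond d m := (v, ⟨0, hd⟩)
  have hF0 : 0 ≤ F := (norm_nonneg _).trans (hzF (v, ⟨0, hd⟩))
  have hαT_ : α ≤ αT := hαle.trans (min_le_left _ _)
  have hαK_ : α ≤ αK := hαle.trans (min_le_right _ _)
  have hjT_ : j₀ ≤ jT := hj.trans (min_le_left _ _)
  have hjK_ : j₀ ≤ jK := hj.trans (min_le_right _ _)
  -- the three CLMs
  obtain ⟨Gtcl, hGtcl⟩ : ∃ T : BondL2K ℂ d (towerP L m (n + 1)) c₀ W →L[ℂ] BondL2K ℂ d (towerP L m (n + 1)) c₀ W,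
      T = LinearMap.toContinuousLinearMap (G1LatticeK hposπ) := ⟨_, rfl⟩
  obtain ⟨Qacl, hQacl⟩ : ∃ T : BondL2K ℂ d m c₁ W →L[ℂ] BondL2K ℂ d (towerP L m (n + 1)) c₀ W,
      T = LinearMap.toContinuousLinearMap (LinearMap.adjoint (QkW L m n φ U hL αU hα1 hU1 hreg (c₀ := c₀) (c₁ := c₁))) := ⟨_, rfl⟩
  obtain ⟨Kpcl, hKpcl⟩ : ∃ T : BondL2K ℂ d m c₁ W →L[ℂ] BondL2K ℂ d m c₁ W, T = LinearMap.toContinuousLinearMap (KinvLatticeK hposπ hQ) := ⟨_, rfl⟩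
  -- (L)(G̃_k; B_T, κ)
  have hG : ∀ (v : TSite d m) (f : BondL2K ℂ d (towerP L m (n + 1)) c₀ W) (F : ℝ),
      (∀ x, blockCoord (L ^ (n + 1)) m (siteCast (towerP_eq_fineP_pow L m (n + 1)) (bpos x)) ≠ v → WL2.equiv ℂ (fun _ : Bond d (towerP L m (n + 1)) => c₀) W f x = 0) →
      (∀ x, ‖WL2.equiv ℂ (fun _ : Bond d (towerP L m (n + 1)) => c₀) W f x‖ ≤ F) →
      ∀ x, ‖WL2.equiv ℂ (fun _ : Bond d (towerP L m (n + 1)) => c₀) W (Gtcl f) x‖ ≤ BT * Real.exp (-(κ * tdist m (blockCoord (L ^ (n + 1)) m (siteCast (towerP_eq_fineP_pow L m (n + 1)) (bpos x))) v)) * F := by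
    intro v f F hfv hfF x
    have hF : 0 ≤ F := (norm_nonneg _).trans (hfF x)
    rw [hGtcl, LinearMap.coe_toContinuousLinearMap']
    exact (HT n η hηL c₀ c₁ hw hρ m hm U αU hα0 hα1 hU1 hreg εU hεU hUε hLb α hα hαT_ hUst hUb hUη hpl hUgrad hRlev hεg hAQ hpos' hpos hc₀η j₀ hJ hjT_
      hposπ v f F hfv hfF x x.1).1.trans
      (mul_le_mul_of_nonneg_right (mul_le_mul_of_nonneg_left (exp_weaken' hκT (tdist_nonneg m _ _)) hBT) hF)
  -- (L)(K̃; B_K, κ)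
  have hK : ∀ (v : TSite d m) (z : BondL2K ℂ d m c₁ W) (F : ℝ), (∀ x, bpos x ≠ v → WL2.equiv ℂ (fun _ : Bond d m => c₁) W z x = 0) →
      (∀ x, ‖WL2.equiv ℂ (fun _ : Bond d m => c₁) W z x‖ ≤ F) →
      ∀ x, ‖WL2.equiv ℂ (fun _ : Bond d m => c₁) W (Kpcl z) x‖ ≤ BK * Real.exp (-(κ * tdist m (bpos x) v)) * F := by
    intro v z F hzv hzF x
    have hF : 0 ≤ F := (norm_nonneg _).trans (hzF x)
    rw [hKpcl, LinearMap.coe_toContinuousLinearMap']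
    exact (HKi n η hηL c₀ c₁ hw hρ m hm U αU hα0 hα1 hαL hU1 hreg εU hεU hUε hLb α hα hαK_ hUst hUb hUη hpl hUgrad hRlev hεg hAQ hpos' hpos hc₀η j₀ hJ hjK_
      hposπ hQ v z F hzv hzF x).trans
      (mul_le_mul_of_nonneg_right (mul_le_mul_of_nonneg_left (exp_weaken' hκK (tdist_nonneg m _ _)) hBK) hF)
  -- (L)(Q_k†; M_Q†·e^κ, κ): size from the single-bond letter, range `1`
  have hdiag : c₁ / c₀ * (Mφ' * ((((L : ℝ) ^ (n + 1)) ^ d)⁻¹ * Real.exp (100 * d * (d + 1) * (L : ℝ) ^ d * AQ)) * Mφ) * ((2 * d : ℕ) : ℝ) = MQa := by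
    have hLp : (0 : ℝ) < ((L : ℝ) ^ (n + 1)) ^ d := pow_pos (pow_pos (Nat.cast_pos.2 hL) _) _
    rw [hMQa, ← hw]
    field_simp
  have hQaM : ∀ (z : BondL2K ℂ d m c₁ W) (F : ℝ), (∀ x, ‖WL2.equiv ℂ (fun _ : Bond d m => c₁) W z x‖ ≤ F) →
      ∀ x, ‖WL2.equiv ℂ (fun _ : Bond d (towerP L m (n + 1)) => c₀) W (Qacl z) x‖ ≤ MQa * F := by
    intro z F hzF x
    have hF : 0 ≤ F := (norm_nonneg _).trans (hzF b')
    have h := norm_adjoint_QkW_apply_le_local_sharp L m n φ (c₀ := c₀) U hL αU hα0 hα1 hU1 hreg hMφ hφ hMφ' hφ' hAQ z x hF (fun c _ => hzF c)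
    rw [hQacl, LinearMap.coe_toContinuousLinearMap', ← hdiag]
    exact h
  have hQaρ : ∀ (v : TSite d m) (z : BondL2K ℂ d m c₁ W), (∀ x, bpos x ≠ v → WL2.equiv ℂ (fun _ : Bond d m => c₁) W z x = 0) →
      ∀ x, (1 : ℝ) < tdist m (blockCoord (L ^ (n + 1)) m (siteCast (towerP_eq_fineP_pow L m (n + 1)) (bpos x))) v →
        WL2.equiv ℂ (fun _ : Bond d (towerP L m (n + 1)) => c₀) W (Qacl z) x = 0 := by
    intro v z hzv x hx
    have hnear : ∀ c : Bond d m, (blockCoord (L ^ (n + 1)) m (siteCast (towerP_eq_fineP_pow L m (n + 1)) x.1) = c.1 ∨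
        blockCoord (L ^ (n + 1)) m (siteCast (towerP_eq_fineP_pow L m (n + 1)) x.1) = shift c.2 c.1) →
        ‖WL2.equiv ℂ (fun _ : Bond d m => c₁) W z c‖ ≤ 0 := by
      intro c hc
      have hcv : bpos c ≠ v := by
        intro hcv
        rcases hc with h1 | h2
        · have : tdist m (blockCoord (L ^ (n + 1)) m (siteCast (towerP_eq_fineP_pow L m (n + 1)) (bpos x))) v = 0 := by
            rw [show bpos x = x.1 from rfl, h1, show c.1 = bpos c from rfl, hcv, tdist_self]
          linarith only [this, hx]
        · have : tdist m (blockCoord (L ^ (n + 1)) m (siteCast (towerP_eq_fineP_pow L m (n + 1)) (bpos x))) v ≤ 1 := by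
            rw [show bpos x = x.1 from rfl, h2, show c.1 = bpos c from rfl, hcv, tdist_symm hm]
            exact tdist_shift_le_one hm v c.2
          linarith only [this, hx]
      rw [hzv c hcv, norm_zero]
    have h := norm_adjoint_QkW_apply_le_local_sharp L m n φ (c₀ := c₀) U hL αU hα0 hα1 hU1 hreg hMφ hφ hMφ' hφ' hAQ z x le_rfl hnear
    rw [mul_zero] at h
    rw [hQacl, LinearMap.coe_toContinuousLinearMap']
    exact norm_le_zero_iff.1 h
  have hQa := letter_of_range (tdist m) (fun c : Bond d m => bpos c) (fun x : Bond d (towerP L m (n + 1)) => blockCoord (L ^ (n + 1)) m (siteCast (towerP_eq_fineP_pow L m (n + 1)) (bpos x))) Qacl (M := MQa) (ρ := 1)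
    (κ := κ) hκ0.le hQaM hQaρ
  -- (K65)'s assembly, one rate loss
  have hS : ∀ w' : TSite d m, ∑ u : TSite d m, Real.exp (-((κ - κ / 2) * tdist m w' u)) ≤ K := fun w' => by
    rw [hKdef]; exact torusSum_le d hm (sub_pos.2 (half_lt_self hκ0)) w'
  have h := local_letter_H1_of_letters (fun x : Bond d (towerP L m (n + 1)) => blockCoord (L ^ (n + 1)) m (siteCast (towerP_eq_fineP_pow L m (n + 1)) (bpos x))) (fun c : Bond d m => bpos c) (tdist m)
    (tdist_nonneg m) (fun u y w' => tdist_triangle hm u y w') Gtcl Qacl Kpcl hBT (mul_nonneg hMQa0 (Real.exp_nonneg _)) hBK (half_pos hκ0).le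
    (half_le_self hκ0.le) hG hQa hK hS v z F hzv hzF b
  have e : (Gtcl ∘L Qacl ∘L Kpcl) z = H1LatticeK hposπ hQ z := by
    rw [hGtcl, hQacl, hKpcl, H1LatticeK_eq]; rfl
  rw [e] at h
  refine h.trans (le_of_eq ?_)
  rw [hBs]

end Literature.MathematicalPhysics.QuantumFieldTheory.Balaban1983to89.B9Eq3126H1kPiSupRowClosed

end
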